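import Summits.QuantumFields.YangMills.Theorems.BalabanUVNodesPortS1FEStepPieces

/-!
# PT-S1 ∕ ⟨27930⟩ — S₄ `FEPolymerResummation`, LEAF (B+C) = THE OBJECTS AND THE TRANSPORT: the torus-level resummed pieces `fePieceT` of a W-format polymer gas ([II] (2.13) read at
# one torus pair, normalised at `U_{k+1} = 1`), the INTEGER-SIDE resummation ★ `feResumInt Hi : IntLocalFormula s` (window-local and `SL(2,ℂ)`-invariant BY CONSTRUCTION), and
# ★★★ `feResumInt_piece_eq_fePieceT` — off the wrap class the formula's pull-back piece IS the torus piece (the centred lift is faithful off the seam)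

Cell `ym-nodeO-ideate` ∕ `ym-balaban-port`, DEFINER seat `ym-nodeO-def-1` (gen 39), S₄ assigned by ★★★ director-ym №638 (2) (nodeO STATUS 2026-08-31 l.6180; plan l.6197);
`--kind definition --supports stmt-QuantumFields-27930 --as helper`; count-neutral.  [I] = [Balaban1987RG1], [II] = [Balaban1988RG2Cluster].

WHY.  S₄ (`FEPolymerResummation`, ✓`…FEStepPieces` :145) asks, for a W-format activity system `(Hi, Hw)` with the Π-rep rows, ONE integer-local formula `Ψ` + wrap pieces `Ew` with the
seven rows of `ResidueOnRegAtW`.  The pieces are the `X`-localised parts `E(X) = Σ_{∪Zᵢ = X} ρ^T ∏ H(Zᵢ)` of `log Ξ` ([II] (2.13)), by difference at the pair and at `U_{k+1} = 1`: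
* §0 TORUS SIDE — `feLocE n X ψ` := lit `B13Resummation.locE` over the catalogue `𝐃_{k+1}(T_{K₀+n})` (footprints = members, incompatibility `TTouch`) with activities `Z ↦ feActAt n Z ψ`;
  ★ `fePieceT n X ψ := feLocE n X ψ − feLocE n X (unitCPair F K)` (the `Ew`; ✓`unitCPair` = the constant pair `(1, 0)` = every cut pair of `B = 0`, ✓`pairCutTorusAt_zero`).
* §1 INTEGER SIDE — the same cluster sum computed in `ℤ⁴` (row (f′) reads the off-wrap pieces from ONE formula at every volume): polymers = the non-empty wall-connected `Y ⊆ X̂`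
  (`intDoms`), incompatibility `ITouch` (the integer twin of `TTouch`), activities `Y ↦ Hi Y f`: `intLocE Hi X̂ f`; `feUnitCfg`; ★ `feResumΨ Hi X̂ f := intLocE Hi X̂ f − intLocE Hi X̂ feUnitCfg`.
* §2 window-locality and `SL(2,ℂ)`-invariance of `feResumΨ Hi` from `Hi`'s rows (termwise, `truncatedWeight_congr`; the integer sites of `Y ⊆ X̂` lie in those of `X̂`); ★ `feResumInt Hi` (the `Ψ`).
* §3 THE CENTRED LIFT IS FAITHFUL OFF THE SEAM: `ctrLift c i := (c i).valMinAbs` (the map of ✓`intCubes`), `proj ∘ ctrLift = id`, `Adj (ctrLift a) (ctrLift b) → TAdj a b` (`proj_adj`), and for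
  OFF-SEAM cubes `TAdj a b → Adj (ctrLift a) (ctrLift b)` (✓`valMinAbs_add_one_of_ne_half`); hence wall-connectedness, the incompatibility (`ITouch ↔ TTouch`) and unions transport.
* §4 ★★ `intLocE_intCubes_eq_feLocE`, ★★★ `feResumInt_piece_eq_fePieceT`: for `X ∉ recordWrapCtr` (no cube on the centred seam) the integer cluster sum at `(intCubes X, ψ ∘ cover)` IS
  `feLocE n X ψ` — sub-polymers of `X` are wrap-free so their activities are `Hi`'s pull-back pieces, the covering families correspond (`image_coveringFamilies_eq`), and the truncated
  functionals are relabeling-invariant (lit `truncatedWeight_image`).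
Leaves (A) the rows on the torus side ((1.18) bound and Kotecký–Preiss smallness from S₄'s binders, identity, locality, invariance), (D) analyticity + ★★★`fePolymerResummation_holds`.

HONEST FRAMING.  Definitions + bookkeeping∕combinatorial lemmas over the tree's Kotecký–Preiss objects; nothing of Bałaban asserted; S₁ ∕ S₃ ∕ `FEStepReg` untouched and inhabited nowhere;
⟨27930⟩ OPEN; NODE O 0∕1; COUNT 8∕28 · K 1∕4 UNMOVED; finite `𝕋⁴_{L^K}` at fixed ε — NOT continuum ∕ ℝ⁴ ∕ OS; **the Yang–Mills mass gap (Clay) is NOT proved by any of this.**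
No `sorry`, `instance`, `notation`; standard axioms.
-/

noncomputable section

open scoped BigOperators Matrix.Norms.L2Operator

namespace Summit.QuantumFields.YangMills.Theorems.BalabanUVNodesPortS1

open Summit.QuantumFields.YangMills.Theorems.K0RecordFormatNames
open Literature.MathematicalPhysics.QuantumFieldTheory.Balaban1983to89
open Literature.MathematicalPhysics.QuantumFieldTheory.Balaban1983to89.Node00
open Literature.MathematicalPhysics.QuantumFieldTheory.Balaban1983to89.T4Continuum (T4Family)
open Literature.MathematicalPhysics.QuantumFieldTheory.Balaban1983to89.B13ScaleTransfer (Adj FaceConnected)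
open Literature.MathematicalPhysics.QuantumFieldTheory.Balaban1983to89.TreeLengthTorusGeometry (TTouch)
open Literature.MathematicalPhysics.QuantumFieldTheory.Balaban1983to89.B13Resummation (locE)
open Literature.Probability.LatticeModels (truncatedWeight truncatedWeight_congr)

/-! ## §0  Torus side: the localised parts and the pieces -/

section Torus

variable (F : T4Family)

open scoped Classical in
/-- **`E(X)(ψ)` — THE `X`-LOCALISED PART OF `log Ξ` FOR THE ACTIVITY SYSTEM `(Hi, Hw)` READ AT ONE TORUS PAIR `ψ`**: lit `B13Resummation.locE` over the polymer catalogue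
`𝐃_{k+1}(T_{K₀+n})` (footprints = the members, incompatibility `TTouch`) with activities `Z ↦ feActAt n Z ψ`. [cite: Balaban1988RG2Cluster, (2.13) p.14] -/
def feLocE (Mc k : ℕ) (Hi : IntLocalFormula (F.L ^ (k + 1) * Mc)) (Hw : TorusPieces F Mc k) (n : ℕ)
    (X : (recordDomSys F Mc k (recordK₀ F Mc k + n)).Dom) (ψ : Sect2.CPair (F.P (recordK₀ F Mc k + n)) (MatA 2)) : ℂ :=
  locE TTouch (fun Z : (recordDomSys F Mc k (recordK₀ F Mc k + n)).Dom => (Z.1 : Finset _)) (fun Z => feActAt F Mc k Hi Hw n Z ψ) (X.1 : Finset _)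

/-- ★ **`fePieceT n X ψ := E(X)(ψ) − E(X)(1, 0)`** — the torus-level resummed piece of the domain `X`, normalised at `U_{k+1} = 1` ([I] (2.13)–(2.14): the `X`-term of (1.7) for
`𝐄^{(k+1)}(U) − 𝐄^{(k+1)}(1)`). [cite: Balaban1987RG1, (2.13)–(2.14) p.268, (1.7) p.261; Balaban1988RG2Cluster, (2.13) p.14] -/
def fePieceT (Mc k : ℕ) (Hi : IntLocalFormula (F.L ^ (k + 1) * Mc)) (Hw : TorusPieces F Mc k) (n : ℕ)
    (X : (recordDomSys F Mc k (recordK₀ F Mc k + n)).Dom) (ψ : Sect2.CPair (F.P (recordK₀ F Mc k + n)) (MatA 2)) : ℂ :=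
  feLocE F Mc k Hi Hw n X ψ - feLocE F Mc k Hi Hw n X (unitCPair F (recordK₀ F Mc k + n))

end Torus

/-! ## §1  Integer side: the polymer system inside `X̂` and the localised cluster sum -/

/-- **Integer incompatibility** («ζ(Z, Z′) = 0 if Z ∩ Z′ contains a cube, or a wall of a cube», [II] (2.11)): `Y` and `Y′` share a cube or a pair of wall-adjacent cubes — the
integer twin of `TreeLengthTorusGeometry.TTouch` (same shape). [cite: Balaban1988RG2Cluster, (2.11) p.14] -/
def ITouch (Y Y' : Finset (Fin 4 → ℤ)) : Prop := ∃ a ∈ Y, ∃ b ∈ Y', a = b ∨ Adj a b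

open scoped Classical in
/-- **The integer polymers inside `X̂`**: the non-empty wall-connected cube sets `Y ⊆ X̂` ([I] p.257: the class `𝐃_j`, read in `ℤ⁴`). [cite: Balaban1987RG1, p.257 (class 𝐃_j)] -/
def intDoms (Xh : Finset (Fin 4 → ℤ)) : Finset (Finset (Fin 4 → ℤ)) :=
  Xh.powerset.filter fun Y => Y.Nonempty ∧ FaceConnected Y

open scoped Classical in
/-- **`intLocE Hi X̂ f` — THE `X̂`-LOCALISED CLUSTER SUM IN `ℤ⁴`**: `Σ_{C ⊆ intDoms X̂, ∪C = X̂} Φ^T(C)` with the truncated functionals of the integer polymer gas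
(incompatibility `ITouch`, activities `Y ↦ Hi Y f`) — [II] (2.13) in Kotecký–Preiss form (lit `B13Resummation.locE`'s shape). [cite: Balaban1988RG2Cluster, (2.13) p.14; KoteckyPreiss1986, (2)–(3)] -/
def intLocE (Hi : IntFormula) (Xh : Finset (Fin 4 → ℤ)) (f : IntBondCfg) : ℂ :=
  ∑ C ∈ (intDoms Xh).powerset with C.biUnion id = Xh, truncatedWeight ITouch (fun Y => Hi Y f) C

/-- **The constant integer-bond configuration `(1, 0)`** (the pull-back of the cut pair of `B = 0`). [cite: Balaban1987RG1, (2.12) p.268 («at U_{k+1} = 1»)] -/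
def feUnitCfg : IntBondCfg := fun _ => (1, 0)

/-- ★ **`feResumΨ Hi X̂ f := intLocE Hi X̂ f − intLocE Hi X̂ (1, 0)`** — the resummed integer formula, normalised at the unit configuration. [cite: Balaban1987RG1, (2.13)–(2.14) p.268; Balaban1988RG2Cluster, (2.13) p.14] -/
def feResumΨ (Hi : IntFormula) : IntFormula := fun Xh f => intLocE Hi Xh f - intLocE Hi Xh feUnitCfg

/-! ## §2  Window-locality and `SL(2,ℂ)`-invariance by construction; the object -/

open scoped Classical in
/-- The members of a family over `intDoms X̂` are subsets of `X̂`. [cite: Balaban1987RG1, p.257 (bookkeeping)] -/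
theorem subset_of_mem_intDoms {Xh Y : Finset (Fin 4 → ℤ)} (hY : Y ∈ intDoms Xh) : Y ⊆ Xh := by
  unfold intDoms at hY
  exact Finset.mem_powerset.1 (Finset.mem_filter.1 hY).1

open scoped Classical in
/-- **`intLocE` reads `f` only through the activities `Hi Y f`, `Y ⊆ X̂`.** [cite: Balaban1988RG2Cluster, (2.13) p.14 (bookkeeping)] -/
theorem intLocE_congr {Hi Hi' : IntFormula} {Xh : Finset (Fin 4 → ℤ)} {f f' : IntBondCfg} (h : ∀ Y, Y ⊆ Xh → Hi Y f = Hi' Y f') :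
    intLocE Hi Xh f = intLocE Hi' Xh f' := by
  unfold intLocE
  refine Finset.sum_congr rfl fun C hC => truncatedWeight_congr fun Y hY => h Y ?_
  exact subset_of_mem_intDoms (Finset.mem_powerset.1 (Finset.mem_filter.1 hC).1 hY)

/-- **(LOC) for the resummed formula**: window-locality at cube side `s` is inherited from `Hi` (the integer sites of `Y ⊆ X̂` lie in those of `X̂`). [cite: Balaban1987RG1, (1.7) p.261] -/
theorem feResumΨ_isLocal {s : ℕ} (Hi : IntLocalFormula s) : (feResumΨ Hi.Ψ).IsLocal s := by
  intro Xh f f' hff'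
  have key : ∀ Y, Y ⊆ Xh → Hi.Ψ Y f = Hi.Ψ Y f' := fun Y hY =>
    Hi.isLocal Y f f' fun zμ hz hzt => hff' zμ (Set.biUnion_subset_biUnion_left hY hz) (Set.biUnion_subset_biUnion_left hY hzt)
  show intLocE Hi.Ψ Xh f - intLocE Hi.Ψ Xh feUnitCfg = intLocE Hi.Ψ Xh f' - intLocE Hi.Ψ Xh feUnitCfg
  rw [intLocE_congr key]

/-- **(GI) for the resummed formula**: invariance under the pulled-back (1.10) action of `SL(2,ℂ)`-valued `û` is inherited from `Hi` termwise. [cite: Balaban1987RG1, (1.19) p.263, (1.10) p.262] -/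
theorem feResumΨ_isGaugeInv {s : ℕ} (Hi : IntLocalFormula s) : (feResumΨ Hi.Ψ).IsGaugeInv := by
  intro Xh û hû f
  show intLocE Hi.Ψ Xh _ - intLocE Hi.Ψ Xh feUnitCfg = intLocE Hi.Ψ Xh f - intLocE Hi.Ψ Xh feUnitCfg
  rw [intLocE_congr (Hi' := Hi.Ψ) (f' := f) fun Y _ => Hi.isGaugeInv Y û hû f]

/-- ★ **`feResumInt Hi : IntLocalFormula s` — THE RESUMMED INTEGER-LOCAL FORMULA** of the activity formula `Hi` (the `Ψ` of S₄'s residue off the wrap class).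
[cite: Balaban1987RG1, (1.7) p.261, (1.19) p.263, (2.13) p.268; Balaban1988RG2Cluster, (2.13) p.14] -/
def feResumInt {s : ℕ} (Hi : IntLocalFormula s) : IntLocalFormula s where
  Ψ := feResumΨ Hi.Ψ
  isLocal := feResumΨ_isLocal Hi
  isGaugeInv := feResumΨ_isGaugeInv Hi

/-- FACE (`rfl`): the formula of `feResumInt Hi`. [cite: Balaban1987RG1, (1.7) p.261 (bookkeeping)] -/
theorem feResumInt_Ψ {s : ℕ} (Hi : IntLocalFormula s) : (feResumInt Hi).Ψ = feResumΨ Hi.Ψ := rfl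


/-! ## §3  The centred integer lift of torus cube indices is faithful off the seam -/

section CtrLift

open Literature.MathematicalPhysics.QuantumFieldTheory.Balaban1983to89.TreeLengthTorus (TPt TAdj proj proj_adj TStepIn TLinked TFaceConnected IsTDom TDom)
open Literature.MathematicalPhysics.QuantumFieldTheory.Balaban1983to89.B13ScaleTransfer (Adj StepIn Linked FaceConnected)

variable {N : ℕ}

/-- **The centred integer lift** of a torus cube index: least-absolute-value residues coordinatewise (the map of ✓`intCubes`). [cite: Balaban1987RG1, (1.21) p.264, p.257] -/
def ctrLift (c : TPt 4 N) : Fin 4 → ℤ := fun i => (c i).valMinAbs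

/-- `proj ∘ ctrLift = id`. [folklore] -/
theorem proj_ctrLift [NeZero N] (c : TPt 4 N) : proj N (ctrLift c) = c := by
  funext i; simp [proj, ctrLift, ZMod.coe_valMinAbs]

/-- The centred lift is injective. [folklore] -/
theorem ctrLift_injective [NeZero N] : Function.Injective (ctrLift (N := N)) := fun a b h => by
  rw [← proj_ctrLift a, ← proj_ctrLift b, h]

/-- Integer wall-adjacency of the lifts gives torus wall-adjacency (`proj_adj`). [cite: Balaban1987RG1, p.257 (bookkeeping)] -/
theorem tadj_of_adj_ctrLift [NeZero N] {a b : TPt 4 N} (h : Adj (ctrLift a) (ctrLift b)) : TAdj a b := by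
  have h' := proj_adj (N := N) h
  rwa [proj_ctrLift, proj_ctrLift] at h'

/-- Off the antipodal value the centred lift commutes with the `+e_i` step. [cite: Balaban1987RG1, (1.21) p.264 (bookkeeping)] -/
theorem ctrLift_update_add_one [NeZero N] (a : TPt 4 N) (i : Fin 4) (ha : (a i).valMinAbs ≠ ((N / 2 : ℕ) : ℤ)) :
    ctrLift (Function.update a i (a i + 1)) = Function.update (ctrLift a) i (ctrLift a i + 1) := by
  funext j
  by_cases hj : j = i
  · subst hj
    simp only [ctrLift, Function.update_self]
    exact valMinAbs_add_one_of_ne_half _ ha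
  · simp only [ctrLift, Function.update_of_ne hj]

/-- **Torus wall-adjacency of OFF-SEAM cubes gives integer wall-adjacency of the lifts.** [cite: Balaban1987RG1, (1.21) p.264, p.257] -/
theorem adj_ctrLift_of_tadj [NeZero N] {a b : TPt 4 N} (h : TAdj a b) (ha : ¬ OnSeamCtr a) (hb : ¬ OnSeamCtr b) :
    Adj (ctrLift a) (ctrLift b) := by
  rw [not_onSeamCtr_iff] at ha hb
  obtain ⟨i, h | h⟩ := h
  · exact ⟨i, Or.inl (by rw [h, ctrLift_update_add_one a i (ha i)])⟩
  · exact ⟨i, Or.inr (by rw [h, ctrLift_update_add_one b i (hb i)])⟩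

/-- **Wall-connectedness transports along the centred lift, torus → integers, off the seam.** [cite: Balaban1987RG1, p.257 (connected families of cubes)] -/
theorem faceConnected_image_ctrLift [NeZero N] {S : Finset (TPt 4 N)} (hS : ∀ c ∈ S, ¬ OnSeamCtr c) (h : TFaceConnected S) :
    FaceConnected (S.image ctrLift) := by
  classical
  intro x hx y hy
  obtain ⟨a, ha, rfl⟩ := Finset.mem_image.1 hx
  obtain ⟨b, hb, rfl⟩ := Finset.mem_image.1 hy
  have hab : TLinked S a b := h a ha b hb
  unfold TLinked at hab
  unfold Linked
  refine Relation.ReflTransGen.lift ctrLift (fun u v huv => ?_) _ _ hab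
  exact ⟨Finset.mem_image_of_mem _ huv.1, Finset.mem_image_of_mem _ huv.2.1, adj_ctrLift_of_tadj huv.2.2 (hS u huv.1) (hS v huv.2.1)⟩

/-- **… and integers → torus** (no seam condition). [cite: Balaban1987RG1, p.257 (connected families of cubes)] -/
theorem tFaceConnected_of_image_ctrLift [NeZero N] {S : Finset (TPt 4 N)} (h : FaceConnected (S.image ctrLift)) : TFaceConnected S := by
  classical
  intro a ha b hb
  have hab : Linked (S.image ctrLift) (ctrLift a) (ctrLift b) := h _ (Finset.mem_image_of_mem _ ha) _ (Finset.mem_image_of_mem _ hb)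
  unfold Linked at hab
  unfold TLinked
  have key : Relation.ReflTransGen (TStepIn S) (proj N (ctrLift a)) (proj N (ctrLift b)) := by
    refine Relation.ReflTransGen.lift (proj N) (fun u v huv => ?_) _ _ hab
    obtain ⟨hu, hv, huv⟩ := huv
    obtain ⟨u', hu', rfl⟩ := Finset.mem_image.1 hu
    obtain ⟨v', hv', rfl⟩ := Finset.mem_image.1 hv
    refine ⟨?_, ?_, proj_adj huv⟩
    · rw [proj_ctrLift]; exact hu'
    · rw [proj_ctrLift]; exact hv'
  rwa [proj_ctrLift, proj_ctrLift] at key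

/-- **The integer incompatibility of the lifts IS the torus incompatibility, off the seam.** [cite: Balaban1988RG2Cluster, (2.11) p.14] -/
theorem iTouch_image_ctrLift_iff [NeZero N] {Z Z' : TDom 4 N} (hZ : ∀ c ∈ Z.1, ¬ OnSeamCtr c) (hZ' : ∀ c ∈ Z'.1, ¬ OnSeamCtr c) :
    ITouch (Z.1.image ctrLift) (Z'.1.image ctrLift) ↔ TTouch Z Z' := by
  classical
  constructor
  · rintro ⟨x, hx, y, hy, hxy⟩
    obtain ⟨a, ha, rfl⟩ := Finset.mem_image.1 hx
    obtain ⟨b, hb, rfl⟩ := Finset.mem_image.1 hy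
    refine ⟨a, ha, b, hb, ?_⟩
    rcases hxy with hxy | hxy
    · exact Or.inl (ctrLift_injective hxy)
    · exact Or.inr (tadj_of_adj_ctrLift hxy)
  · rintro ⟨a, ha, b, hb, hab⟩
    refine ⟨ctrLift a, Finset.mem_image_of_mem _ ha, ctrLift b, Finset.mem_image_of_mem _ hb, ?_⟩
    rcases hab with hab | hab
    · exact Or.inl (by rw [hab])
    · exact Or.inr (adj_ctrLift_of_tadj hab (hZ a ha) (hZ' b hb))

/-- The family map `Z ↦ Z.image ctrLift` is injective. [folklore] -/
theorem image_ctrLift_injective [NeZero N] : Function.Injective (fun Z : TDom 4 N => Z.1.image ctrLift) := fun _ _ h =>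
  Subtype.ext (Finset.image_injective ctrLift_injective h)

end CtrLift

/-! ## §4  Off the wrap class the integer cluster sum IS the torus-level localised part -/

section Transport

variable (F : T4Family)

open Literature.MathematicalPhysics.QuantumFieldTheory.Balaban1983to89.TreeLengthTorus (TPt TAdj proj TFaceConnected IsTDom TDom)
open Literature.MathematicalPhysics.QuantumFieldTheory.Balaban1983to89.B13ScaleTransfer (Adj FaceConnected)
open Literature.MathematicalPhysics.QuantumFieldTheory.Balaban1983to89.B13FamilySum (coveringFamilies mem_coveringFamilies)
open Literature.Probability.LatticeModels (truncatedWeight_image)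

variable {F} in
/-- Off the wrap class, no cube of the domain lies on the centred seam. [cite: Balaban1987RG1, (1.21) p.264 (bookkeeping)] -/
theorem not_onSeamCtr_of_not_mem_wrap {Mc k K : ℕ} {X : (recordDomSys F Mc k K).Dom} (hX : X ∉ recordWrapCtr F Mc k K) :
    ∀ c ∈ (X.1 : Finset _), ¬ OnSeamCtr c := by
  classical
  intro c hc hs
  exact hX (Finset.mem_filter.2 ⟨Finset.mem_univ _, c, hc, hs⟩)

/-- `intCubes` is the image under the centred lift. [cite: Balaban1987RG1, p.257 (bookkeeping)] -/
theorem intCubes_eq_image_ctrLift (Mc k K : ℕ) (X : (recordDomSys F Mc k K).Dom) :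
    intCubes F Mc k K X = (X.1 : Finset _).image ctrLift := rfl

open scoped Classical in
/-- **THE FAMILY CORRESPONDENCE**: for a wrap-free `X`, the covering families of `X` in `𝐃_{k+1}(T_K)` map bijectively, by `Z ↦ Z.image ctrLift`, onto the families of integer
polymers inside `X̂ = intCubes X` with union `X̂`. [cite: Balaban1988RG2Cluster, (2.13) p.14; Balaban1987RG1, (1.21) p.264] -/
theorem image_coveringFamilies_eq {Mc k K : ℕ} (X : (recordDomSys F Mc k K).Dom) (hX : X ∉ recordWrapCtr F Mc k K) :
    (coveringFamilies (Finset.univ : Finset (recordDomSys F Mc k K).Dom) (fun Z => (Z.1 : Finset _)) X.1).image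
        (fun C => C.image fun Z : (recordDomSys F Mc k K).Dom => (Z.1 : Finset _).image ctrLift) =
      (intDoms (intCubes F Mc k K X)).powerset.filter fun C' => C'.biUnion id = intCubes F Mc k K X := by
  have hoff := not_onSeamCtr_of_not_mem_wrap hX
  ext C'
  simp only [Finset.mem_image, Finset.mem_filter, Finset.mem_powerset, intCubes_eq_image_ctrLift]
  constructor
  · rintro ⟨C, hC, rfl⟩
    obtain ⟨-, hU⟩ := mem_coveringFamilies.1 hC
    have hsub : ∀ Z ∈ C, (Z.1 : Finset _) ⊆ X.1 := fun Z hZ => by rw [← hU]; exact Finset.subset_biUnion_of_mem _ hZ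
    refine ⟨fun Y hY => ?_, ?_⟩
    · obtain ⟨Z, hZ, rfl⟩ := Finset.mem_image.1 hY
      unfold intDoms
      refine Finset.mem_filter.2 ⟨Finset.mem_powerset.2 (Finset.image_subset_image (hsub Z hZ)), (Z.2.1).image _, ?_⟩
      exact faceConnected_image_ctrLift (fun c hc => hoff c (hsub Z hZ hc)) Z.2.2
    · rw [Finset.image_biUnion, ← hU]
      exact Finset.biUnion_image.symm
  · rintro ⟨hC', hU'⟩
    -- every member is the lift of a sub-domain of `X`
    have hmem : ∀ Y ∈ C', ∃ Z : (recordDomSys F Mc k K).Dom, (Z.1 : Finset _) ⊆ X.1 ∧ (Z.1 : Finset _).image ctrLift = Y := by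
      intro Y hY
      have hYd := hC' hY
      unfold intDoms at hYd
      obtain ⟨hYX, hYne, hYc⟩ := Finset.mem_filter.1 hYd
      rw [Finset.mem_powerset] at hYX
      have hback : (Y.image (proj (Sect2.domCount (F.P K) Mc (k + 1)))).image ctrLift = Y := by
        rw [Finset.image_image]
        refine (Finset.image_congr fun y hy => ?_).trans Finset.image_id'
        obtain ⟨c, -, rfl⟩ := Finset.mem_image.1 (hYX hy)
        show ctrLift (proj _ (ctrLift c)) = ctrLift c
        rw [proj_ctrLift]
      have hsubX : Y.image (proj (Sect2.domCount (F.P K) Mc (k + 1))) ⊆ X.1 := by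
        intro a ha
        obtain ⟨y, hy, rfl⟩ := Finset.mem_image.1 ha
        obtain ⟨c, hc, rfl⟩ := Finset.mem_image.1 (hYX hy)
        rw [proj_ctrLift]; exact hc
      have hdom : IsTDom (Y.image (proj (Sect2.domCount (F.P K) Mc (k + 1)))) :=
        ⟨hYne.image _, tFaceConnected_of_image_ctrLift (by rw [hback]; exact hYc)⟩
      exact ⟨⟨_, hdom⟩, hsubX, hback⟩
    haveI : Nonempty (recordDomSys F Mc k K).Dom := ⟨X⟩
    choose! Zof hZsub hZimg using hmem
    refine ⟨C'.image Zof, mem_coveringFamilies.2 ⟨Finset.subset_univ _, ?_⟩, ?_⟩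
    · apply Finset.image_injective ctrLift_injective
      show ((C'.image Zof).biUnion fun Z => (Z.1 : Finset _)).image ctrLift = X.1.image ctrLift
      rw [← hU']
      calc ((C'.image Zof).biUnion fun Z => (Z.1 : Finset _)).image ctrLift = (C'.image Zof).biUnion fun Z => (Z.1 : Finset _).image ctrLift :=
            Finset.biUnion_image
        _ = C'.biUnion fun Y => ((Zof Y).1 : Finset _).image ctrLift := Finset.image_biUnion
        _ = C'.biUnion id := Finset.biUnion_congr rfl fun Y hY => hZimg Y hY
    · rw [Finset.image_image]
      refine (Finset.image_congr fun Y hY => ?_).trans Finset.image_id'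
      exact hZimg Y hY

open scoped Classical in
/-- ★★ **OFF THE WRAP CLASS THE INTEGER CLUSTER SUM IS THE TORUS-LEVEL LOCALISED PART**: for `X ∉ recordWrapCtr`, `intLocE Hi (intCubes X) (ψ ∘ cover) = feLocE n X ψ` —
every sub-polymer of `X` is wrap-free so its activity is `Hi`'s pull-back piece, the centred lift carries sub-domains, `TTouch` and unions faithfully (§3), and the truncated functionals are
relabeling-invariant (lit `truncatedWeight_image`). [cite: Balaban1988RG2Cluster, (2.13) p.14; Balaban1987RG1, (1.7) p.261, (1.21) p.264] -/
theorem intLocE_intCubes_eq_feLocE {Mc k : ℕ} (Hi : IntLocalFormula (F.L ^ (k + 1) * Mc)) (Hw : TorusPieces F Mc k) (n : ℕ)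
    (X : (recordDomSys F Mc k (recordK₀ F Mc k + n)).Dom) (hX : X ∉ recordWrapCtr F Mc k (recordK₀ F Mc k + n))
    (ψ : Sect2.CPair (F.P (recordK₀ F Mc k + n)) (MatA 2)) :
    intLocE Hi.Ψ (intCubes F Mc k (recordK₀ F Mc k + n) X) (pullPair F (recordK₀ F Mc k + n) ψ) = feLocE F Mc k Hi Hw n X ψ := by
  have hoff := not_onSeamCtr_of_not_mem_wrap hX
  unfold intLocE feLocE locE
  rw [← image_coveringFamilies_eq F X hX, Finset.sum_image]
  · refine Finset.sum_congr rfl fun C hC => ?_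
    obtain ⟨-, hU⟩ := mem_coveringFamilies.1 hC
    have hsub : ∀ Z ∈ C, (Z.1 : Finset _) ⊆ X.1 := fun Z hZ => by rw [← hU]; exact Finset.subset_biUnion_of_mem _ hZ
    refine truncatedWeight_image (image_ctrLift_injective.injOn) (fun a ha b hb => ?_) (fun Z hZ => ?_)
    · exact iTouch_image_ctrLift_iff (fun c hc => hoff c (hsub a ha hc)) (fun c hc => hoff c (hsub b hb hc))
    · show Hi.Ψ ((Z.1 : Finset _).image ctrLift) (pullPair F _ ψ) = feActAt F Mc k Hi Hw n Z ψ
      unfold feActAt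
      rw [if_neg (not_mem_recordWrapCtr_of_subset hX (hsub Z hZ))]
      rfl
  · exact (Finset.image_injective image_ctrLift_injective).injOn

/-- The pull-back of the unit pair is the unit configuration. [cite: Balaban1987RG1, (2.12) p.268 (bookkeeping)] -/
theorem pullPair_unitCPair (K : ℕ) : pullPair F K (unitCPair F K) = feUnitCfg := rfl

/-- ★★★ **OFF THE WRAP CLASS, THE RESUMMED FORMULA's PULL-BACK PIECE IS THE TORUS PIECE**: `(feResumInt Hi).Ψ.piece X ψ = fePieceT n X ψ` for `X ∉ recordWrapCtr`.
[cite: Balaban1987RG1, (1.7) p.261, (1.21) p.264, (2.13)–(2.14) p.268; Balaban1988RG2Cluster, (2.13) p.14] -/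
theorem feResumInt_piece_eq_fePieceT {Mc k : ℕ} (Hi : IntLocalFormula (F.L ^ (k + 1) * Mc)) (Hw : TorusPieces F Mc k) (n : ℕ)
    (X : (recordDomSys F Mc k (recordK₀ F Mc k + n)).Dom) (hX : X ∉ recordWrapCtr F Mc k (recordK₀ F Mc k + n))
    (ψ : Sect2.CPair (F.P (recordK₀ F Mc k + n)) (MatA 2)) :
    (feResumInt Hi).Ψ.piece F Mc k (recordK₀ F Mc k + n) X ψ = fePieceT F Mc k Hi Hw n X ψ := by
  show intLocE Hi.Ψ _ (pullPair F _ ψ) - intLocE Hi.Ψ _ feUnitCfg = feLocE F Mc k Hi Hw n X ψ - feLocE F Mc k Hi Hw n X (unitCPair F _)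
  rw [intLocE_intCubes_eq_feLocE F Hi Hw n X hX ψ, ← pullPair_unitCPair F, intLocE_intCubes_eq_feLocE F Hi Hw n X hX]

end Transport

end Summit.QuantumFields.YangMills.Theorems.BalabanUVNodesPortS1

end
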